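import Mathlib
import Summits.ValiantsHypothesis.ValiantsHypothesis.Theorems.FifoMatchingNNDivisionHardFewSummandsTransport
import Summits.ValiantsHypothesis.ValiantsHypothesis.Theorems.FifoMatchingNNDivisionHardZonotopeProducts
import HarnessLib

/-!
# ★★★ `NNDivisionHard` ON PRODUCTS OF POLYNOMIALLY MANY SPARSE FACTORS, ANY DEGREES — the FEW-SUMMANDS LAW in the crux's currency
# (crux `Theses.FifoMatching.NNDivisionHard`, stmt-ValiantsHypothesis-21181)

WHAT IS NEW.  The tree's NN-currency tiers decide cofactors by Newton DIMENSION (✓ `…LowDimRate`), by GENERATOR COUNT (✓ `…FewGeneratorsExp`),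
by PARALLEL FLATS (✓ `…FewFlatsExp`), and — this hand — ZONOTOPES with `n^{O(1)}` zones (✓ `…ZonotopeCofactors` / `…ZonotopeProducts`:
products of segment-supported factors).  The named survivor after those was «products of many TRIANGLE-supported (or any small-support)
factors»: `Π_{i<M} p_i` with `|supp p_i| ≤ m` has up to `m^M` vertices, Newton dimension up to `M(m−1)`, no flat / zonotope structure.
The FEW-SUMMANDS LAW (✓ `…FewSummandsLaw.summands_decided`, COR level, ARBITRARY summands) read on `NN_n` (✓ `…FewSummandsTransport.nn_prod_fewSummands`)
decides them all:

* ★★★ `nnDivisionHard_fewSummands` — for all `c k`, eventually in `n`: every `hh ≠ 0` over `ℝ≥0` whose Newton polytope is a Minkowski sum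
  `conv{w + Σ_{i<M} vtx i (f i) : f : [M] → [m]}` of `M` polytopes with `m` listed points each, `M·m² ≤ n^k`, satisfies the crux's literal
  inequality `2^((log₂ n + c)^c) < L₊(NN_n · hh) + L₊(hh)`;
* ★★★ `nnDivisionHard_prod_sparseFactors` — the member theorem: every PRODUCT `Π_{i<M} p_i ≠ 0` of `M` factors with `|supp p_i| ≤ m`
  and `M·m² ≤ n^k` — ANY degrees, ANY supports — satisfies the crux's inequality (e.g. products of `n^3` arbitrary trinomials of
  degree `2^n`; all products of `≤ n^k` factors of `≤ n^k` monomials each).  `m = 2`: the zonotope tier; `M = 1`: the few-monomials tier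
  at polynomial count.

MECHANISM: `Newt(Π p_i) = Σ_i Newt(p_i)` (✓ `Zono.newtonPolytope_prod`), each `Newt(p_i) = conv(supp p_i)` listed with repetitions by `m`
points, `convexHull_sum`; then ✓ `nn_prod_fewSummands` with the zone parameters of ✓ `Zono.zone_params` and the rate plumbing of
✓ `Zono.nnDivisionHard_zonotope` verbatim.  No definitions, no named facts, no sorry.

HONEST FRAMING: a restriction theorem (a decided sub-class of cofactors), NOT the crux: stmt-21181 `NNDivisionHard` OPEN — a surviving cheap
cofactor must now have a Newton polytope that is NOT a Minkowski sum of `n^{O(1)}` polytopes with `n^{O(1)}` points each (nor low-dimensional,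
few-generated, on few flats): e.g. products of `n^{ω(1)}` factors, or «prime» polytopes with many vertices such as `(Σ_e x_e)^D`-type
factors of super-polynomial support mixed by products; COR-VIRTUAL OPEN; `NNNotVP` OPEN; `VP ≠ VNP` NOT proved.
References: Hrubeš–Yehudayoff 2021 §6 Problem 2 [HrubesYehudayoff2021]; Kaibel–Weltge 2015 [KaibelWeltge2014]; Blekherman–Parrilo–Thomas 2012
(3.21) [BlekhermanParriloThomas2012].
-/

set_option autoImplicit false

-- the mandated summit-side namespace repeats a component by design (single-problem summit)
set_option linter.dupNamespace false

noncomputable section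

open Matrix Finset
open scoped Pointwise

namespace Summit.ValiantsHypothesis.ValiantsHypothesis.Theorems.FifoMatching

namespace Summands

open Literature.Barriers.PneNP (HasEFOfSize)
open MvPolynomial
open scoped NNReal
open Literature.Computability.AlgebraicComplexity (complexity nestFreeMatchingPoly)
open Literature.Computability.AlgebraicComplexity.MonotoneCircuitEF (hasEFOfSize_newtonPolytope_complexity)
open Literature.Algebra.Polynomial.NewtonPolytope (newtonPolytope newtonPolytope_mul)
open Summit.ValiantsHypothesis.ValiantsHypothesis.Theorems.FifoMatching.XcDivision (T_pow_four_le)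
open Summit.ValiantsHypothesis.ValiantsHypothesis.Theorems.FifoMatching.QueueGridFace (realOf suppPts newt)
open Summit.ValiantsHypothesis.ValiantsHypothesis.Theorems.FifoMatching.MonomialCofactor (newt_eq_newtonPolytope)
open Summit.ValiantsHypothesis.ValiantsHypothesis.Theorems.FifoMatching.Zono (zone_params zones_threshold newtonPolytope_prod)

/-! ## §1 In the crux's currency -/

/-- ★★★ **`NNDivisionHard` ON COFACTORS WHOSE NEWTON POLYTOPE IS A MINKOWSKI SUM OF POLYNOMIALLY MANY SMALL POLYTOPES (PROVED,
unconditional):** for all `c k`, eventually in `n`, every `hh ≠ 0` over `ℝ≥0` whose Newton polytope is `conv{w + Σ_{i<M} vtx i (f i) : f}`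
(`M` summands of `m ≥ 1` listed points, ANY vectors) with `M·m² ≤ n^k` satisfies `2^((log₂ n + c)^c) < L₊(NN_n · hh) + L₊(hh)`.
[cite: HrubesYehudayoff2021, §6 Problem 2] [cite: KaibelWeltge2014, Thm. 1] -/
theorem nnDivisionHard_fewSummands (c k : ℕ) : ∃ n₀ : ℕ, ∀ n ≥ n₀,
    ∀ hh : MvPolynomial (Fin (2 * n) × Fin (2 * n)) ℝ≥0, hh ≠ 0 →
      ∀ {M m : ℕ}, 1 ≤ m → ∀ (vtx : Fin M → Fin m → (Fin (2 * n) × Fin (2 * n)) → ℝ)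
        (w : (Fin (2 * n) × Fin (2 * n)) → ℝ),
        newtonPolytope (MvPolynomial.map NNReal.toRealHom hh) =
          convexHull ℝ (Set.range fun f : Fin M → Fin m => w + ∑ i, vtx i (f i)) →
        M * (m * m) ≤ n ^ k →
          2 ^ ((Nat.log 2 n + c) ^ c) < complexity (nestFreeMatchingPoly n ℝ≥0 * hh) + complexity hh := by
  obtain ⟨cA, hcA, t₀, htrans⟩ := nn_prod_fewSummands
  set cm : ℝ := min cA 1 with hcm
  have hcm0 : 0 < cm := lt_min hcA one_pos
  have hcmA : cm ≤ cA := min_le_left _ _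
  have hcm1 : cm ≤ 1 := min_le_right _ _
  obtain ⟨N, hN⟩ := zones_threshold (4 ^ (c + 1) + c + 1) k
  obtain ⟨S₁, hS₁⟩ := exists_nat_ge ((20 / cm) ^ 2)
  obtain ⟨S₀, hS₀a, hS₀b, hS₀c, hS₀d⟩ :
      ∃ S₀ : ℕ, 4 * t₀ + 4 ≤ S₀ ∧ (2 ^ N) ^ 2 ≤ S₀ ∧ S₁ ≤ S₀ ∧ 16 ≤ S₀ :=
    ⟨4 * t₀ + 4 + (2 ^ N) ^ 2 + S₁ + 16, by omega, by omega, by omega, by omega⟩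
  refine ⟨S₀ ^ 2, fun n hn hh hh0 M m hm vtx w hQ hMk => ?_⟩
  classical
  by_contra hle
  push Not at hle
  have hEF : HasEFOfSize (newtonPolytope (MvPolynomial.map NNReal.toRealHom (nestFreeMatchingPoly n ℝ≥0)) +
      convexHull ℝ (Set.range fun f : Fin M → Fin m => w + ∑ i, vtx i (f i))) (3 * 2 ^ ((Nat.log 2 n + c) ^ c)) := by
    have h1 := hasEFOfSize_newtonPolytope_complexity (nestFreeMatchingPoly n ℝ≥0 * hh)
    rw [map_mul, newtonPolytope_mul, hQ] at h1
    exact h1.of_le (by omega)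
  obtain ⟨s, hs⟩ : ∃ s, s = Nat.sqrt n := ⟨_, rfl⟩
  have hsS : S₀ ≤ s := by rw [hs]; exact Nat.le_sqrt'.2 hn
  have hss : s ^ 2 ≤ n := by rw [hs]; exact Nat.sqrt_le' n
  have hns : n < (s + 1) ^ 2 := by rw [hs]; exact Nat.lt_succ_sqrt' n
  obtain ⟨g, hg⟩ : ∃ g, g = s / 4 := ⟨_, rfl⟩
  have h4g : 4 * g ≤ s := by rw [hg]; exact Nat.mul_div_le s 4
  have hg4 : s < 4 * (g + 1) := by rw [hg]; omega
  have hg1 : 1 ≤ g := by omega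
  have hgt : t₀ ≤ g := by omega
  have hn' : (2 * g + 1) * (2 * (2 * g) + 1) ≤ n := by nlinarith [Nat.mul_le_mul h4g h4g]
  obtain ⟨h, hch, hlaw⟩ := htrans n (2 * g) g (by omega) hn' (le_refl _) hgt hm vtx w _ hEF
  -- `h` is large
  have hsqrt_s : Real.sqrt s * Real.sqrt s = s := Real.mul_self_sqrt (Nat.cast_nonneg s)
  have hg_real : (s : ℝ) / 4 - 1 ≤ g := by
    have : (s : ℝ) < 4 * ((g : ℝ) + 1) := by exact_mod_cast hg4
    linarith
  have h1 : cm * ((s : ℝ) / 4 - 1) ≤ h :=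
    calc cm * ((s : ℝ) / 4 - 1) ≤ cm * g := mul_le_mul_of_nonneg_left hg_real hcm0.le
      _ ≤ cA * g := mul_le_mul_of_nonneg_right hcmA (Nat.cast_nonneg g)
      _ ≤ h := hch
  have hreal : Real.sqrt s + 1 ≤ (h : ℝ) := by
    have hS₁s : ((20 / cm) ^ 2 : ℝ) ≤ s := le_trans hS₁ (by exact_mod_cast (show S₁ ≤ s by omega))
    have hsq : 20 / cm ≤ Real.sqrt s := by
      rw [show (20 / cm : ℝ) = Real.sqrt ((20 / cm) ^ 2) by rw [Real.sqrt_sq (by positivity)]]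
      exact Real.sqrt_le_sqrt hS₁s
    have h20 : 20 ≤ cm * Real.sqrt s := by
      have := mul_le_mul_of_nonneg_left hsq hcm0.le
      rwa [show cm * (20 / cm) = 20 by field_simp] at this
    have h2 : 20 * Real.sqrt s ≤ cm * s := by
      have := mul_le_mul_of_nonneg_right h20 (Real.sqrt_nonneg s)
      rw [mul_assoc, hsqrt_s] at this
      exact this
    have hs1 : 1 ≤ Real.sqrt s := by
      rw [show (1 : ℝ) = Real.sqrt 1 by simp]
      exact Real.sqrt_le_sqrt (by exact_mod_cast (show 1 ≤ s by omega))
    nlinarith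
  have hhN : 2 ^ N ≤ h := by
    have : ((2 ^ N : ℕ) : ℝ) ≤ Real.sqrt s := by
      rw [show ((2 ^ N : ℕ) : ℝ) = Real.sqrt (((2 ^ N : ℕ) : ℝ) ^ 2) by rw [Real.sqrt_sq (Nat.cast_nonneg _)]]
      exact Real.sqrt_le_sqrt (by exact_mod_cast (show (2 ^ N) ^ 2 ≤ s by omega))
    exact_mod_cast (by linarith : ((2 ^ N : ℕ) : ℝ) ≤ h)
  have hn4 : n < h ^ 4 := by
    have hs1 : s + 1 ≤ h ^ 2 := by
      have : (s : ℝ) + 1 ≤ (h : ℝ) ^ 2 := by nlinarith [Real.sqrt_nonneg s]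
      exact_mod_cast this
    calc n < (s + 1) ^ 2 := hns
      _ ≤ (h ^ 2) ^ 2 := Nat.pow_le_pow_left hs1 2
      _ = h ^ 4 := by rw [← pow_mul]
  have hn0 : n ≠ 0 := by
    have : 16 ^ 2 ≤ s ^ 2 := Nat.pow_le_pow_left (by omega) 2
    omega
  -- the zone parameters and the few-summands law
  obtain ⟨t, ht1, hmt, hcount⟩ := zone_params (C := 4 ^ (c + 1) + c + 1) hN hhN hn4 hMk
  have hlt := hlaw (4 ^ (c + 1) + c + 1) t ht1 hmt hcount
  have hT := T_pow_four_le (c := c) hn0 hn4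
  have hT2 : 2 ≤ 2 ^ ((Nat.log 2 n + c) ^ c) := by
    show 2 ^ 1 ≤ 2 ^ _
    exact Nat.pow_le_pow_right (by norm_num)
      (Nat.one_le_pow _ _ (by
        have h256 : 16 ^ 2 ≤ S₀ ^ 2 := Nat.pow_le_pow_left hS₀d 2
        have := Nat.log_pos one_lt_two (show 2 ≤ n by omega)
        omega))
  have h8 : 8 * 2 ^ ((Nat.log 2 n + c) ^ c) ≤ (2 ^ ((Nat.log 2 n + c) ^ c)) ^ 4 := by
    have : 2 ^ 3 ≤ (2 ^ ((Nat.log 2 n + c) ^ c)) ^ 3 := Nat.pow_le_pow_left hT2 3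
    calc 8 * 2 ^ ((Nat.log 2 n + c) ^ c) = 2 ^ 3 * 2 ^ ((Nat.log 2 n + c) ^ c) := by norm_num
      _ ≤ (2 ^ ((Nat.log 2 n + c) ^ c)) ^ 3 * 2 ^ ((Nat.log 2 n + c) ^ c) := Nat.mul_le_mul_right _ this
      _ = (2 ^ ((Nat.log 2 n + c) ^ c)) ^ 4 := by ring
  omega

/-! ## §2 The member theorem: products of sparse factors -/

/-- the support of a nonzero `p` with `|supp p| ≤ m`, LISTED by `m ≥ 1` points (with repetitions): a surjection onto `suppPts p`.
[folklore] -/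
theorem exists_list_suppPts {n m : ℕ} (p : MvPolynomial (Fin (2 * n) × Fin (2 * n)) ℝ≥0) (hp : p ≠ 0)
    (hcard : p.support.card ≤ m) :
    ∃ v : Fin m → (Fin (2 * n) × Fin (2 * n)) → ℝ, Set.range v = suppPts p := by
  classical
  set s := p.support with hs
  have hne : s.Nonempty := MvPolynomial.support_nonempty.2 hp
  have hc : 1 ≤ s.card := Finset.card_pos.2 hne
  let e : Fin s.card ≃ ↥s := s.equivFin.symm
  let idx : Fin m → Fin s.card := fun b => ⟨min b.1 (s.card - 1), by omega⟩
  refine ⟨fun b => realOf (σ := Fin (2 * n) × Fin (2 * n)) (e (idx b)).1, ?_⟩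
  ext x
  simp only [Set.mem_range, suppPts, Set.mem_image, Finset.mem_coe]
  constructor
  · rintro ⟨b, rfl⟩
    exact ⟨(e (idx b)).1, (e (idx b)).2, rfl⟩
  · rintro ⟨d, hd, rfl⟩
    obtain ⟨j, hj⟩ := e.surjective ⟨d, hd⟩
    refine ⟨⟨j.1, by omega⟩, ?_⟩
    have hidx : idx ⟨j.1, by omega⟩ = j := by
      apply Fin.ext
      simp only [idx]
      omega
    rw [hidx, hj]

/-- the Minkowski sum of the listed ranges is the range of the product family. [folklore] -/
theorem sum_range_eq_range_prodFamily {E : Type} [AddCommMonoid E] {M m : ℕ} (v : Fin M → Fin m → E) :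
    ∑ i, Set.range (v i) = Set.range (fun f : Fin M → Fin m => ∑ i, v i (f i)) := by
  ext a
  rw [Set.mem_fintype_sum]
  constructor
  · rintro ⟨g, hg, rfl⟩
    choose f hf using fun i => Set.mem_range.1 (hg i)
    exact ⟨f, by simp only [hf]⟩
  · rintro ⟨f, rfl⟩
    exact ⟨fun i => v i (f i), fun i => ⟨f i, rfl⟩, rfl⟩

/-- ★★★ **PRODUCTS OF POLYNOMIALLY MANY SPARSE FACTORS ARE NOT CERTIFICATES (PROVED, unconditional):** for all `c k`, eventually in `n`,
every product `Π_{i<M} p_i ≠ 0` over `ℝ≥0` with `|supp p_i| ≤ m` (`m ≥ 1`) and `M·m² ≤ n^k` satisfies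
`2^((log₂ n + c)^c) < L₊(NN_n · Π p_i) + L₊(Π p_i)` — ANY degrees, ANY supports.
[cite: HrubesYehudayoff2021, §6 Problem 2] [cite: BlekhermanParriloThomas2012, Ch. 3 §3.3.4 (3.21)] -/
theorem nnDivisionHard_prod_sparseFactors (c k : ℕ) : ∃ n₀ : ℕ, ∀ n ≥ n₀, ∀ (M m : ℕ), 1 ≤ m → M * (m * m) ≤ n ^ k →
    ∀ (p : Fin M → MvPolynomial (Fin (2 * n) × Fin (2 * n)) ℝ≥0),
      (∀ i, (p i).support.card ≤ m) → ∏ i, p i ≠ 0 →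
        2 ^ ((Nat.log 2 n + c) ^ c) <
          complexity (nestFreeMatchingPoly n ℝ≥0 * ∏ i, p i) + complexity (∏ i, p i) := by
  obtain ⟨n₀, hn₀⟩ := nnDivisionHard_fewSummands c k
  refine ⟨n₀, fun n hn M m hm hMk p hsupp hne => ?_⟩
  classical
  have hp0 : ∀ i, p i ≠ 0 := fun i hi => hne (Finset.prod_eq_zero (Finset.mem_univ i) hi)
  choose v hv using fun i => exists_list_suppPts (p i) (hp0 i) (hsupp i)
  refine hn₀ n hn (∏ i, p i) hne hm v 0 ?_ hMk
  rw [map_prod, newtonPolytope_prod]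
  have hterm : ∀ i, newtonPolytope (MvPolynomial.map NNReal.toRealHom (p i)) = convexHull ℝ (Set.range (v i)) := by
    intro i; rw [← newt_eq_newtonPolytope]; unfold newt; rw [hv i]
  rw [Finset.sum_congr rfl fun i _ => hterm i, ← convexHull_sum, sum_range_eq_range_prodFamily]
  simp only [zero_add]

end Summands

end Summit.ValiantsHypothesis.ValiantsHypothesis.Theorems.FifoMatching

end
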